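import Literature.MathematicalPhysics.QuantumFieldTheory.Balaban1983to89.B12Ineq45
import Literature.MathematicalPhysics.QuantumFieldTheory.Balaban1983to89.B15PrelimIntegrations
import Literature.MathematicalPhysics.QuantumFieldTheory.Balaban1983to89.B15BasicStep
import Literature.MathematicalPhysics.QuantumFieldTheory.Balaban1983to89.B15StandardRep

/-!
# `Balaban1983to89.B15HDecayLeaves` — [Balaban1989LargeFieldI] §1: the four `ℍ`-DECAY INPUT LEAVES (1.38)₁ p. 185,
# (1.45) p. 186, (1.57)₁ p. 188, (1.90)₁ p. 198 DISCHARGED modulo the tree's typed (190) of [15] = [Balaban1985Variational]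
# (`B11SectG.Ineq190`), the row sum (2.61) of [3] = [Balaban1984PropagatorsII] (`B11SectG.RowSum`) and the printed
# localisation data of the argument fields

statement-level skeleton of published theorems with citation tags; proofs where landed; nothing here is a claim about
the Yang–Mills mass gap.

CITATION HEADER (lean-in-tree rule 2026-08-18).  T. Bałaban, *Large field renormalization. I. The basic step of the 𝐑
operation*, Commun. Math. Phys. **122**, 175–202 (1989), doi:10.1007/BF01257412, bib `Balaban1989LargeFieldI` (cell
paper B15; PDF held `paper:balaban1989-cmp122-large-field-i`, journal page = PDF page + 174; pp. 185–188, 198 = PDF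
11–14, 24).  "[15]" of the paper = T. Bałaban, CMP **102** (1985) 277–309 [Balaban1985Variational], Prop. 9 / (190)
p. 308–309 (tree: `B11.Prop9Printed`, and the block-majorant form `B11SectG.Ineq190 bB bout dH C δ₀` = *"δ𝓗 has the
majorant C·e^{−⅛δ₀d(y,y′)} from the B-size bB into the local size bout"*, scale weights inside the sizes); "[3]" =
[Balaban1984PropagatorsII] Lemma 2.1 (2.61) p. 234 (tree: `B11SectG.RowSum g σ c`).  WHAT IS REPRODUCED: SKELETON rows
`B15.Eq1.38` (first inequality), `B15.Eq1.45`, `B15.Eq1.57` (first member), `B15.Eq1.90` (`BoundH190`), `B15.Eq1.87` (v1.1), `B15.Eq1.97` (v1.2: the p. 199 ℍ-bounds), unit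
`lit-balaban-r12` gen 8 (reader/typer and fold owner of block B15), HOME `run/shared/lean/pub/lit-balaban/`
(`lit-balaban-r12/ROWS-B15.md`).  Used BY NAME, nothing restated: pv12's `B12Ineq45.loc_dH_le_of_ineq190_localised`
(the *"additional exponential factor"* lemma: decay of `dH B` from the localisation of `B`), `B11SectG.{BlockNorm,
Ineq190, RowSum}`, r12's typed leaves `B15.PrelimIntegrations.Ineq145`, `Ineq138`, b01's `B15.BasicStep.Ineq157`, r12's
`B15StandardRep.BoundH190`.  Pattern = `B12Decay510FromB11` (the leaf `hh` of (5.10) discharged from (190)).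

THE PRINTED TEXT (verbatim; v1.3: the (1.38) and (1.57) passages re-read on the page images PDF 11 / 14 and restored —
v1–v1.2 carried here, inside the quotation marks, two paraphrases that are not printed sentences: «The function ℍ^{(j)}
satisfies the usual bounds with exponential decay and a field bounded by 4δ′_j on Ω^c_{j+1}∖Z″_{j+1}, localized as
described above, hence …» and «the field −(1/i)log[…] is localized in the layer of the thickness 2M₁ at the boundary ∂Z,
and it can be estimated there by 44d²B₃ε_k …»; `lit-balaban-r12/QUOTE-AUDIT-B15.md` findings A6/A10; docstring only, no
declaration, statement or proof changed).  (1.38) p. 185: *"Consider now the field in the argument of the function ℍ. On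
the domain Ω_{j+1}∩Z_{j+1}, except a boundary layer of the width 2LM₁ at the boundary ∂Z_{j+1}, this field is equal to
0. On the boundary layer it can be bounded by 22d²ε_{j+1}. Similarly, on the domain Ω^c_j∩Z^c_j [sic; p. 184 (the sentence before (1.34)) has Ω^c_{j+1}∩Z^c_j for the same domain],
except a boundary layer of the width 2M₁ at the boundary ∂Z^c_j, the field is equal to (1/i)log[V_j(V_Z^{(j)})⁻¹], hence it can be bounded by
4δ′_j, as it follows from the restrictions in (1.27). On the boundary layer it can be bounded by 22d²ε_j. From this, and
the exponential decay property, it follows that |ℍ| < B₃(4δ′_j + exp(−δMR_{j+1})22d²ε_{j+1} + exp(−δ6LMR_{j+1})22d²ε_j)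
…"* [the argument field has three pieces: `4δ′_j` on `Ω^c_{j+1}∖Z″_{j+1}`, `22d²ε_{j+1}` in a layer at distance
`≥ MR_{j+1}`, `22d²ε_j` in a layer at distance `≥ 6LMR_{j+1}`]; (1.45) p. 186: *"The field in the argument of the
function ℍ^{(n)}_k is bounded by 4δ′_j, and is localized in the domain Ω^c_{j+1}∖Z″_{j+1}, therefore the following
estimate holds: sup_{B^i(y)} L^iη|ℍ^{(n)}_{k,Z}|, sup_{B^i(y)} (L^iη)²|∇^η_{U^{(n+1)}_k}ℍ^{(n)}_{k,Z}| ≦ B₃exp(−δd(y,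
Ω^c_{j+1}∖Z″_{j+1}))4δ′_j. (1.45) Here d(·,·) is the scaled distance, y is a point of the i-th component of the
determining set 𝔹_k^{(n)}."*; (1.56)–(1.57) p. 188: *"The field in the argument of the function ℍ^{(n+1)}_{k,Z} has a
support in the boundary layer of the width 2M₁ at the boundary of Z, and is bounded by 44d²B₃ε_k. Thus the function
considered on the domain Ω^c_{j+1}∖Z″_{j+1} satisfies the bound |ℍ^{(n+1)}_{k,Z}| ≦ (L^{j+1}η)^{−1}B₃exp(−δ10M(R_{j+1} +
⋯ + R_{k−1}) − δMR_k)44d²B₃ε_k < 44d²B₃²(1 + β₀)exp(−R_j)ε_j. (1.57)"* (with p. 177 *"Each renormalization step adds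
at least ten layers of MR_k-cubes"*); (1.90) p. 198: *"The function ℍ_{h,□} and
it[s] derivatives can be bounded on □^∼ by B₃exp(−δ2LM₂R_h)11d²ε_h"*.  [15] (190) p. 308: *"|(δ/δB_ν(y′))𝓗_μ(B,x)|,
|∇_x(δ/δB_ν(y′))𝓗_μ(B,x)|, … ≤ O(1)[(L^jη)^{−1}, (L^jη)^{−2}, …]·(L^{j′}η)^{−d} exp(−⅛δ₀d(y,y′)) for x ∈ Δ(y), y ∈ Λ_j,
y′ ∈ Λ_{j′}"*; [3] (2.61) p. 234: *"sup_{y∈𝔅} Σ_{y′∈𝔅} e^{−αδ₀d(y,y′)} ≤ c₁(α)"*.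

WHAT IS PROVED (0 `sorry`, no `def`, no new `Prop`).  Over the block-majorant vocabulary (`g : B6.Geometry` = the
multiscale set with its distance `d`, `bB` = the B-size of the argument field, `bout` = a local size of the values —
for (1.45) the two sizes `sup_{B^i(y)} L^iη|·|` and `sup_{B^i(y)} (L^iη)²|∇·|`, whose weights are print's `(L^jη)^{−1}`,
`(L^jη)^{−2}` of (190)):
* `loc_le_three_pieces` — for a linear `dH` with (190) (`Ineq190`, constant `C`), the row sum (2.61) at rate `σ`, any
  rate `τ ≥ 0` with `σ + τ ≤ ⅛δ₀`, and an argument `B = B₁ + B₂ + B₃` whose pieces have B-sizes `≤ m_i` and vanish on the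
  blocks `y′` with `d(y, y′) < D_i`: `bout.loc y (dH B) ≤ Cκ_Bc·(m₁e^{−τD₁} + m₂e^{−τD₂} + m₃e^{−τD₃})` (three applications of
  pv12's one-piece lemma + subadditivity of the size).
* `loc_le_of_meanValue`, `loc_le_three_pieces_of_meanValue` — the same bounds for the VALUE `ℍ(B)` of the (nonlinear)
  function of Prop. 9 when every base-point derivative `dH t` (`t` in any index type: the segment `tB`, Prop. 9 giving
  (190) on the whole ball) satisfies (190) with the same constants and `ℍ(B)` is dominated by the common bounds of the
  `dH t B` (hypothesis `hmv` — the mean-value reading of *"𝓗 … satisfies (190) [for its derivative]"* ⇒ bounds on 𝓗(B),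
  𝓗(0) = 0).
* **(1.45)** `ineq145_of_ineq190`: r12's leaf `Ineq145 (bout₀.loc y ℍB) (bout₁.loc y ℍB) (Cκ_Bc) τ dist δ′_j` from: (190) for
  the two sizes, (2.61), the field bound `bB.loc y′ B ≤ 4δ′_j` and its localisation `bB.loc y′ B ≠ 0 → dist ≤ d(y,y′)`
  (`dist = d(y, Ω^c_{j+1}∖Z″_{j+1})`) — i.e. (1.45) with `B₃ = Cκ_Bc`, `δ = τ`.
* **(1.38)₁** `ineq138_first_of_ineq190`: r12's leaf `Ineq138 (bout.loc y ℍB) B₃ δ′_j τ M R L d ε_j ε_{j+1}` from the three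
  pieces (`4δ′_j` at distance `≥ 0`, `22d²ε_{j+1}` at distance `≥ MR`, `22d²ε_j` at distance `≥ 6LMR`), for any `B₃ > Cκ_Bc`
  (print's strict `<`; `δ′_j > 0`).
* **(1.57)₁** `ineq157_first_of_ineq190`: the first member of b01's `Ineq157` for `H = Lpow·bout.loc y ℍB` (`Lpow =
  (L^{j+1}η)^{−1}` undoing the weight of the size) from one piece of B-size `≤ 44d²B₃ε_k` localised at distance `D` with
  `δ(10MΣR) + δMR_k ≤ τD` (the ten-layers geometry of p. 177 as the hypothesis) and `Cκ_Bc ≤ B₃`.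
* **(1.90)₁** `boundH190_of_ineq190`: r12's `BoundH190 (bout.loc y ℍB) B₃ δ L M₂ R_h d ε_h` from one piece of B-size
  `≤ 11d²ε_h` localised at distance `D` with `δ2LM₂R_h ≤ τD`, `Cκ_Bc ≤ B₃`.
* **(1.87)** (v1.1) `ineq187_of_ineq190`: r12's/b01's leaf `B15.BasicStep.Ineq187 a da dda C′ B₃ B₅ M ε_k` — p. 197
  *"|𝔸₀|, |∇^η𝔸₀|, |∂^{η*}∂^η𝔸₀| < O(1)B₃²B₅M⁶ε_k on Z″_k"* for `𝔸₀ = ℍ_{k,Λ}((1/i)log M˙(U₀))` ((1.86)) — from (190) for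
  the three sizes (UNLOCALISED: pv12's `loc_dH_le_of_ineq190`), (2.61), the B-size of the argument `≤ m ≤ K·B₃B₅M⁶ε_k`
  ((1.84) *"|M^j(U₀) − 1| < O(1)B₃B₅M⁶ε_k"* through the chart `(1/i)log`, `K` = chart constant × the O(1) of (1.84)),
  `Cκ_Bc ≤ B₃` (print's second factor `B₃`), and any `C′ > K` (print's strict `<`; `B₃²B₅M⁶ε_k > 0`).
* **p. 199** (v1.2) `boundH199B_of_ineq190`, `boundH199C_of_ineq190`: the two `ℍ`-function bounds of p. 199 feeding
  (1.97)/(1.98) — *"The ℍ-function in the expansion can be bounded on the domain Z″_{j+1}∖Z″_j … by B₃exp(−δ(M/M₁)(j −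
  h))exp(−½δMR_h)23d²ε_h"* (one localised piece: field `≤ 23d²ε_h`, distance `D` with `δ(M/M₁)(j−h) + ½δMR_h ≤ τD`) and
  *"The corresponding ℍ-function can be bounded on the same domains as above by B₃δ′_k"* (unlocalised, field `≤ δ′_k`) —
  the first members of r12's `B15Bounds199.chainB_le` / `chainC_le`.
HONEST SCOPE.  (190) itself, (2.61), the identification of print's sups with the local sizes, the B-size bounds of the
argument fields (`4δ′_j`, `22d²ε`, `44d²B₃ε_k`, `11d²ε_h` — consequences of the restrictions (1.27), (1.30), (1.56), (1.90))
and their localisation distances are HYPOTHESES in the printed shapes; the mean-value domination `hmv` is the declared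
reading of how Prop. 9's derivative bound controls 𝓗(B).  Value = the four decay leaves of §1 reduced to ONE typed
published inequality ((190)) plus located data, kernel-checked; NOT summit progress.
-/

namespace Literature.MathematicalPhysics.QuantumFieldTheory.Balaban1983to89.B15HDecayLeaves

open Literature.MathematicalPhysics.QuantumFieldTheory.Balaban1983to89
open B11SectG B12Ineq45 B15.PrelimIntegrations B15.BasicStep B15StandardRep

variable {g : B6.Geometry} {FB FA : Type} [AddCommGroup FB] [Module ℝ FB] [AddCommGroup FA] [Module ℝ FA]

/-! ## §1. Linear level: one piece (pv12) and three pieces -/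

/-- One localised piece, pv12's lemma at a single block `y`: B-size `≤ m`, vanishing on the blocks `y′` with
`d(y, y′) < D` ⇒ `bout.loc y (dH B) ≤ Cκ_Bc·m·e^{−τD}`. [cite: Balaban1985Variational, (190) p.308] -/
theorem loc_le_one_piece {bB : BlockNorm g FB} {bout : BlockNorm g FA} {dH : FB →ₗ[ℝ] FA} {C δ₀ σ τ c m D : ℝ}
    (h190 : Ineq190 bB bout dH C δ₀) (hC : 0 ≤ C) (hd : ∀ a b : g.Site, 0 ≤ g.dist a b) (hrow : RowSum g σ c)
    (hτ : 0 ≤ τ) (hστ : σ + τ ≤ δ₀ / 8) (B : FB) (hm : ∀ y', bB.loc y' B ≤ m) (y : g.Site)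
    (hD : ∀ y', bB.loc y' B ≠ 0 → D ≤ g.dist y y') :
    bout.loc y (dH B) ≤ C * bB.κ * c * m * Real.exp (-(τ * D)) :=
  loc_dH_le_of_ineq190_localised h190 hC hd hrow hτ hστ B hm ({y} : Set g.Site)
    (fun y₁ hy₁ y' hne => by rw [Set.mem_singleton_iff.mp hy₁]; exact hD y' hne) (Set.mem_singleton y)

/-- **Three localised pieces** (the shape of (1.38)₁): `B = B₁ + B₂ + B₃`, B-sizes `≤ mᵢ`, piece `i` vanishing on the
blocks `y′` with `d(y, y′) < Dᵢ` ⇒ `bout.loc y (dH B) ≤ Cκ_Bc·(m₁e^{−τD₁} + m₂e^{−τD₂} + m₃e^{−τD₃})`.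
[cite: Balaban1989LargeFieldI, (1.38) p.185; Balaban1985Variational, (190) p.308] -/
theorem loc_le_three_pieces {bB : BlockNorm g FB} {bout : BlockNorm g FA} {dH : FB →ₗ[ℝ] FA} {C δ₀ σ τ c : ℝ}
    (h190 : Ineq190 bB bout dH C δ₀) (hC : 0 ≤ C) (hd : ∀ a b : g.Site, 0 ≤ g.dist a b) (hrow : RowSum g σ c)
    (hτ : 0 ≤ τ) (hστ : σ + τ ≤ δ₀ / 8) {B₁ B₂ B₃ : FB} {m₁ m₂ m₃ D₁ D₂ D₃ : ℝ} (y : g.Site)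
    (hm₁ : ∀ y', bB.loc y' B₁ ≤ m₁) (hD₁ : ∀ y', bB.loc y' B₁ ≠ 0 → D₁ ≤ g.dist y y')
    (hm₂ : ∀ y', bB.loc y' B₂ ≤ m₂) (hD₂ : ∀ y', bB.loc y' B₂ ≠ 0 → D₂ ≤ g.dist y y')
    (hm₃ : ∀ y', bB.loc y' B₃ ≤ m₃) (hD₃ : ∀ y', bB.loc y' B₃ ≠ 0 → D₃ ≤ g.dist y y') :
    bout.loc y (dH (B₁ + B₂ + B₃)) ≤
      C * bB.κ * c * (m₁ * Real.exp (-(τ * D₁)) + m₂ * Real.exp (-(τ * D₂)) + m₃ * Real.exp (-(τ * D₃))) := by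
  have h₁ := loc_le_one_piece h190 hC hd hrow hτ hστ B₁ hm₁ y hD₁
  have h₂ := loc_le_one_piece h190 hC hd hrow hτ hστ B₂ hm₂ y hD₂
  have h₃ := loc_le_one_piece h190 hC hd hrow hτ hστ B₃ hm₃ y hD₃
  rw [map_add, map_add]
  have hsub : bout.loc y (dH B₁ + dH B₂ + dH B₃) ≤ bout.loc y (dH B₁) + bout.loc y (dH B₂) + bout.loc y (dH B₃) :=
    (bout.loc_add_le y _ _).trans (by linarith [bout.loc_add_le y (dH B₁) (dH B₂)])
  have hring : C * bB.κ * c * (m₁ * Real.exp (-(τ * D₁)) + m₂ * Real.exp (-(τ * D₂)) + m₃ * Real.exp (-(τ * D₃)))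
      = C * bB.κ * c * m₁ * Real.exp (-(τ * D₁)) + C * bB.κ * c * m₂ * Real.exp (-(τ * D₂))
        + C * bB.κ * c * m₃ * Real.exp (-(τ * D₃)) := by ring
  linarith

/-! ## §2. The value `ℍ(B)` through the base-point derivatives (mean-value reading of Prop. 9) -/

/-- **One piece for the value `ℍ(B)`**: if every base-point derivative `dH t` satisfies (190) with the constants `C, δ₀`
and `ℍB` is dominated by the common bounds of the `dH t B` (`hmv`), the one-piece bound holds for `bout.loc y ℍB`.
[cite: Balaban1985Variational, Prop. 9 (190) p.309] -/
theorem loc_le_of_meanValue {T : Type*} {bB : BlockNorm g FB} {bout : BlockNorm g FA} {dH : T → FB →ₗ[ℝ] FA}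
    {C δ₀ σ τ c m D : ℝ} (h190 : ∀ t, Ineq190 bB bout (dH t) C δ₀) (hC : 0 ≤ C)
    (hd : ∀ a b : g.Site, 0 ≤ g.dist a b) (hrow : RowSum g σ c) (hτ : 0 ≤ τ) (hστ : σ + τ ≤ δ₀ / 8)
    (B : FB) (hm : ∀ y', bB.loc y' B ≤ m) (y : g.Site) (hD : ∀ y', bB.loc y' B ≠ 0 → D ≤ g.dist y y')
    {HB : FA} (hmv : ∀ s : ℝ, (∀ t, bout.loc y (dH t B) ≤ s) → bout.loc y HB ≤ s) :
    bout.loc y HB ≤ C * bB.κ * c * m * Real.exp (-(τ * D)) :=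
  hmv _ fun t => loc_le_one_piece (h190 t) hC hd hrow hτ hστ B hm y hD

/-- **Three pieces for the value `ℍ(B)`** (the shape of (1.38)₁). [cite: Balaban1989LargeFieldI, (1.38) p.185] -/
theorem loc_le_three_pieces_of_meanValue {T : Type*} {bB : BlockNorm g FB} {bout : BlockNorm g FA}
    {dH : T → FB →ₗ[ℝ] FA} {C δ₀ σ τ c : ℝ} (h190 : ∀ t, Ineq190 bB bout (dH t) C δ₀) (hC : 0 ≤ C)
    (hd : ∀ a b : g.Site, 0 ≤ g.dist a b) (hrow : RowSum g σ c) (hτ : 0 ≤ τ) (hστ : σ + τ ≤ δ₀ / 8)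
    {B₁ B₂ B₃ : FB} {m₁ m₂ m₃ D₁ D₂ D₃ : ℝ} (y : g.Site)
    (hm₁ : ∀ y', bB.loc y' B₁ ≤ m₁) (hD₁ : ∀ y', bB.loc y' B₁ ≠ 0 → D₁ ≤ g.dist y y')
    (hm₂ : ∀ y', bB.loc y' B₂ ≤ m₂) (hD₂ : ∀ y', bB.loc y' B₂ ≠ 0 → D₂ ≤ g.dist y y')
    (hm₃ : ∀ y', bB.loc y' B₃ ≤ m₃) (hD₃ : ∀ y', bB.loc y' B₃ ≠ 0 → D₃ ≤ g.dist y y')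
    {HB : FA} (hmv : ∀ s : ℝ, (∀ t, bout.loc y (dH t (B₁ + B₂ + B₃)) ≤ s) → bout.loc y HB ≤ s) :
    bout.loc y HB ≤
      C * bB.κ * c * (m₁ * Real.exp (-(τ * D₁)) + m₂ * Real.exp (-(τ * D₂)) + m₃ * Real.exp (-(τ * D₃))) :=
  hmv _ fun t => loc_le_three_pieces (h190 t) hC hd hrow hτ hστ y hm₁ hD₁ hm₂ hD₂ hm₃ hD₃

/-! ## §3. The four leaves of §1 -/

/-- **(1.45) p. 186 FROM (190)**: with the two local sizes of (1.45) (`bout₀` = `sup_{B^i(y)} L^iη|·|`, `bout₁` =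
`sup_{B^i(y)} (L^iη)²|∇^η·|`, print's weights `(L^jη)^{−1}`, `(L^jη)^{−2}` of (190)), (190) for both at every base point,
(2.61) at rate `σ`, a rate `τ ≥ 0` with `σ + τ ≤ ⅛δ₀`, the argument field `B` of (1.44) with *"bounded by 4δ′_j"*
(`bB.loc y′ B ≤ 4δ′_j`) and *"localized in the domain Ω^c_{j+1}∖Z″_{j+1}"* (`bB.loc y′ B ≠ 0 → dist ≤ d(y, y′)`, `dist =
d(y, Ω^c_{j+1}∖Z″_{j+1})`), and the mean-value domination for both sizes: r12's leaf `Ineq145 sH sDH B₃ δ dist δ′_j` holds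
for `sH = bout₀.loc y ℍB`, `sDH = bout₁.loc y ℍB`, `B₃ = Cκ_Bc`, `δ = τ`. [cite: Balaban1989LargeFieldI, (1.45) p.186;
Balaban1985Variational, (190) p.308; Balaban1984PropagatorsII, Lemma 2.1 (2.61) p.234] -/
theorem ineq145_of_ineq190 {T : Type*} {bB : BlockNorm g FB} {bout₀ bout₁ : BlockNorm g FA}
    {dH : T → FB →ₗ[ℝ] FA} {C δ₀ σ τ c δ'j dist : ℝ}
    (h190₀ : ∀ t, Ineq190 bB bout₀ (dH t) C δ₀) (h190₁ : ∀ t, Ineq190 bB bout₁ (dH t) C δ₀) (hC : 0 ≤ C)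
    (hd : ∀ a b : g.Site, 0 ≤ g.dist a b) (hrow : RowSum g σ c) (hτ : 0 ≤ τ) (hστ : σ + τ ≤ δ₀ / 8)
    (B : FB) (hm : ∀ y', bB.loc y' B ≤ 4 * δ'j) (y : g.Site) (hD : ∀ y', bB.loc y' B ≠ 0 → dist ≤ g.dist y y')
    {HB : FA} (hmv₀ : ∀ s : ℝ, (∀ t, bout₀.loc y (dH t B) ≤ s) → bout₀.loc y HB ≤ s)
    (hmv₁ : ∀ s : ℝ, (∀ t, bout₁.loc y (dH t B) ≤ s) → bout₁.loc y HB ≤ s) :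
    Ineq145 (bout₀.loc y HB) (bout₁.loc y HB) (C * bB.κ * c) τ dist δ'j := by
  have h₀ := loc_le_of_meanValue h190₀ hC hd hrow hτ hστ B hm y hD hmv₀
  have h₁ := loc_le_of_meanValue h190₁ hC hd hrow hτ hστ B hm y hD hmv₁
  unfold Ineq145
  have e : C * bB.κ * c * (4 * δ'j) * Real.exp (-(τ * dist)) = C * bB.κ * c * Real.exp (-(τ * dist)) * (4 * δ'j) := by
    ring
  rw [e] at h₀ h₁
  exact ⟨h₀, h₁⟩

/-- **(1.38), first inequality, p. 185 FROM (190)**: the argument field of ℍ^{(j)} in three localised pieces — `B₁` with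
B-size `≤ 4δ′_j` (on `Ω^c_{j+1}∖Z″_{j+1}`, distance `≥ 0` from the bond's block), `B₂` with B-size `≤ 22d²ε_{j+1}` vanishing
on the blocks closer than `MR` (`R = R_{j+1}`), `B₃` with B-size `≤ 22d²ε_j` vanishing on the blocks closer than `6LMR` —,
(190) at every base point, (2.61), `σ + τ ≤ ⅛δ₀`, the mean-value domination, `δ′_j > 0`, signs, and any `B₃ > Cκ_Bc`
(print's strict `<`): r12's leaf `Ineq138 (bout.loc y ℍB) B₃ δ′_j τ M R L d ε_j ε_{j+1}`. [cite: Balaban1989LargeFieldI, (1.38) p.185; Balaban1985Variational, (190) p.308] -/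
theorem ineq138_first_of_ineq190 {T : Type*} {bB : BlockNorm g FB} {bout : BlockNorm g FA}
    {dH : T → FB →ₗ[ℝ] FA} {C δ₀ σ τ c δ'j M R L d εj εj1 B₃ : ℝ}
    (h190 : ∀ t, Ineq190 bB bout (dH t) C δ₀) (hC : 0 ≤ C) (hd : ∀ a b : g.Site, 0 ≤ g.dist a b)
    (hrow : RowSum g σ c) (hτ : 0 ≤ τ) (hστ : σ + τ ≤ δ₀ / 8) {B₁ B₂ B₃p : FB} (y : g.Site)
    (hm₁ : ∀ y', bB.loc y' B₁ ≤ 4 * δ'j) (hD₁ : ∀ y', bB.loc y' B₁ ≠ 0 → 0 ≤ g.dist y y')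
    (hm₂ : ∀ y', bB.loc y' B₂ ≤ 22 * d ^ 2 * εj1) (hD₂ : ∀ y', bB.loc y' B₂ ≠ 0 → M * R ≤ g.dist y y')
    (hm₃ : ∀ y', bB.loc y' B₃p ≤ 22 * d ^ 2 * εj) (hD₃ : ∀ y', bB.loc y' B₃p ≠ 0 → 6 * L * M * R ≤ g.dist y y')
    {HB : FA} (hmv : ∀ s : ℝ, (∀ t, bout.loc y (dH t (B₁ + B₂ + B₃p)) ≤ s) → bout.loc y HB ≤ s)
    (hδ'j : 0 < δ'j) (hε : 0 ≤ εj) (hε1 : 0 ≤ εj1) (hB₃ : C * bB.κ * c < B₃) :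
    Ineq138 (bout.loc y HB) B₃ δ'j τ M R L d εj εj1 := by
  have h := loc_le_three_pieces_of_meanValue h190 hC hd hrow hτ hστ y hm₁ hD₁ hm₂ hD₂ hm₃ hD₃ hmv
  unfold Ineq138
  have hbr : 0 < 4 * δ'j + Real.exp (-(τ * M * R)) * (22 * d ^ 2) * εj1
      + Real.exp (-(τ * 6 * L * M * R)) * (22 * d ^ 2) * εj := by positivity
  have e1 : 4 * δ'j * Real.exp (-(τ * 0)) + 22 * d ^ 2 * εj1 * Real.exp (-(τ * (M * R)))
      + 22 * d ^ 2 * εj * Real.exp (-(τ * (6 * L * M * R)))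
      = 4 * δ'j + Real.exp (-(τ * M * R)) * (22 * d ^ 2) * εj1
        + Real.exp (-(τ * 6 * L * M * R)) * (22 * d ^ 2) * εj := by
    rw [mul_zero, neg_zero, Real.exp_zero, mul_one]
    have e2 : τ * (M * R) = τ * M * R := by ring
    have e3 : τ * (6 * L * M * R) = τ * 6 * L * M * R := by ring
    rw [e2, e3]
    ring
  rw [e1] at h
  have hlt := mul_lt_mul_of_pos_right hB₃ hbr
  linarith

/-- **(1.57), first member, p. 188 FROM (190)**: the argument field of ℍ^{(n+1)}_{k,Z} has B-size `≤ 44d²B₃ε_k`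
(p. 188: *"has a support in the boundary layer of the width 2M₁ at the boundary of Z, and is bounded by 44d²B₃ε_k"*) and
vanishes on the blocks closer than `D` to the block `y` of scale `j + 1`, where the ten-layers geometry of p. 177 gives
`δ(10M(R_{j+1} + ⋯ + R_{k−1})) + δMR_k ≤ τD`; with (190) at every base point for the size `bout` (weight `(L^{j+1}η)`),
(2.61), `σ + τ ≤ ⅛δ₀`, the mean-value domination, `Cκ_Bc ≤ B₃`, `Lpow ≥ 0` (print's `(L^{j+1}η)^{−1}` undoing the weight)
and signs: the first member of b01's `Ineq157`, `Lpow·bout.loc y ℍB ≤ Lpow·B₃e^{−δ10MΣR − δMR_k}44d²B₃ε_k`.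
[cite: Balaban1989LargeFieldI, (1.57) p.188; Balaban1985Variational, (190) p.308] -/
theorem ineq157_first_of_ineq190 {T : Type*} {bB : BlockNorm g FB} {bout : BlockNorm g FA}
    {dH : T → FB →ₗ[ℝ] FA} {C δ₀ σ τ c D Lpow B₃ δ M sumR Rk d εk : ℝ}
    (h190 : ∀ t, Ineq190 bB bout (dH t) C δ₀) (hC : 0 ≤ C) (hd : ∀ a b : g.Site, 0 ≤ g.dist a b)
    (hrow : RowSum g σ c) (hτ : 0 ≤ τ) (hστ : σ + τ ≤ δ₀ / 8) (B : FB) (y : g.Site)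
    (hm : ∀ y', bB.loc y' B ≤ 44 * d ^ 2 * B₃ * εk) (hD : ∀ y', bB.loc y' B ≠ 0 → D ≤ g.dist y y')
    {HB : FA} (hmv : ∀ s : ℝ, (∀ t, bout.loc y (dH t B) ≤ s) → bout.loc y HB ≤ s)
    (hgeom : δ * 10 * M * sumR + δ * M * Rk ≤ τ * D) (hCB : C * bB.κ * c ≤ B₃) (hLpow : 0 ≤ Lpow)
    (hB₃ : 0 ≤ B₃) (hεk : 0 ≤ εk) :
    Lpow * bout.loc y HB ≤ Lpow * B₃ * Real.exp (-(δ * 10 * M * sumR) - δ * M * Rk) * (44 * d ^ 2) * B₃ * εk := by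
  have h := loc_le_of_meanValue h190 hC hd hrow hτ hστ B hm y hD hmv
  have hexp : Real.exp (-(τ * D)) ≤ Real.exp (-(δ * 10 * M * sumR) - δ * M * Rk) :=
    Real.exp_le_exp.mpr (by linarith)
  have ha : 0 ≤ 44 * d ^ 2 * B₃ * εk := by positivity
  have h2 : C * bB.κ * c * (44 * d ^ 2 * B₃ * εk) * Real.exp (-(τ * D))
      ≤ B₃ * (44 * d ^ 2 * B₃ * εk) * Real.exp (-(δ * 10 * M * sumR) - δ * M * Rk) :=
    mul_le_mul (mul_le_mul_of_nonneg_right hCB ha) hexp (Real.exp_nonneg _) (by positivity)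
  have h3 := mul_le_mul_of_nonneg_left (h.trans h2) hLpow
  calc Lpow * bout.loc y HB ≤ Lpow * (B₃ * (44 * d ^ 2 * B₃ * εk) * Real.exp (-(δ * 10 * M * sumR) - δ * M * Rk)) := h3
    _ = Lpow * B₃ * Real.exp (-(δ * 10 * M * sumR) - δ * M * Rk) * (44 * d ^ 2) * B₃ * εk := by ring

/-- **(1.90), first member, p. 198 FROM (190)**: the argument field of ℍ_{h,□} has B-size `≤ 11d²ε_h` and vanishes on the
blocks closer than `D` to the block `y` of `□^∼`, with `δ2LM₂R_h ≤ τD` (its localisation at distance `2LM₂R_h`); with (190)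
at every base point, (2.61), `σ + τ ≤ ⅛δ₀`, the mean-value domination, `Cκ_Bc ≤ B₃` and signs: r12's
`BoundH190 (bout.loc y ℍB) B₃ δ L M₂ R_h d ε_h`. [cite: Balaban1989LargeFieldI, (1.90) p.198; Balaban1985Variational, (190) p.308] -/
theorem boundH190_of_ineq190 {T : Type*} {bB : BlockNorm g FB} {bout : BlockNorm g FA}
    {dH : T → FB →ₗ[ℝ] FA} {C δ₀ σ τ c D B₃ δ L M₂ Rh d εh : ℝ}
    (h190 : ∀ t, Ineq190 bB bout (dH t) C δ₀) (hC : 0 ≤ C) (hd : ∀ a b : g.Site, 0 ≤ g.dist a b)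
    (hrow : RowSum g σ c) (hτ : 0 ≤ τ) (hστ : σ + τ ≤ δ₀ / 8) (B : FB) (y : g.Site)
    (hm : ∀ y', bB.loc y' B ≤ 11 * d ^ 2 * εh) (hD : ∀ y', bB.loc y' B ≠ 0 → D ≤ g.dist y y')
    {HB : FA} (hmv : ∀ s : ℝ, (∀ t, bout.loc y (dH t B) ≤ s) → bout.loc y HB ≤ s)
    (hgeom : δ * 2 * L * M₂ * Rh ≤ τ * D) (hCB : C * bB.κ * c ≤ B₃) (hB₃ : 0 ≤ B₃) (hεh : 0 ≤ εh) :
    BoundH190 (bout.loc y HB) B₃ δ L M₂ Rh d εh := by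
  have h := loc_le_of_meanValue h190 hC hd hrow hτ hστ B hm y hD hmv
  unfold BoundH190
  have hexp : Real.exp (-(τ * D)) ≤ Real.exp (-(δ * 2 * L * M₂ * Rh)) := Real.exp_le_exp.mpr (by linarith)
  have ha : 0 ≤ 11 * d ^ 2 * εh := by positivity
  have h2 : C * bB.κ * c * (11 * d ^ 2 * εh) * Real.exp (-(τ * D))
      ≤ B₃ * (11 * d ^ 2 * εh) * Real.exp (-(δ * 2 * L * M₂ * Rh)) :=
    mul_le_mul (mul_le_mul_of_nonneg_right hCB ha) hexp (Real.exp_nonneg _) (by positivity)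
  calc bout.loc y HB ≤ B₃ * (11 * d ^ 2 * εh) * Real.exp (-(δ * 2 * L * M₂ * Rh)) := h.trans h2
    _ = B₃ * Real.exp (-(δ * 2 * L * M₂ * Rh)) * (11 * d ^ 2) * εh := by ring

/-! ## §4 (v1.1). (1.87) p. 197: the Landau-gauge field `𝔸₀` from (1.84) and (190), unlocalised -/

/-- **Unlocalised value bound**: if every base-point derivative `dH t` satisfies (190) for the size `bout` and `ℍB` is
dominated by the common bounds of the `dH t B`, then `bout.loc y ℍB ≤ Cκ_Bc·m` for an argument of B-size `≤ m`
(pv12's `loc_dH_le_of_ineq190` + the mean-value domination). [cite: Balaban1985Variational, Prop. 9 (190) p.309] -/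
theorem loc_le_global_of_meanValue {T : Type*} {bB : BlockNorm g FB} {bout : BlockNorm g FA}
    {dH : T → FB →ₗ[ℝ] FA} {C δ₀ σ c m : ℝ} (h190 : ∀ t, Ineq190 bB bout (dH t) C δ₀) (hC : 0 ≤ C)
    (hd : ∀ a b : g.Site, 0 ≤ g.dist a b) (hrow : RowSum g σ c) (hσ : σ ≤ δ₀ / 8) (B : FB)
    (hm : ∀ y', bB.loc y' B ≤ m) (y : g.Site) {HB : FA}
    (hmv : ∀ s : ℝ, (∀ t, bout.loc y (dH t B) ≤ s) → bout.loc y HB ≤ s) :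
    bout.loc y HB ≤ C * bB.κ * c * m :=
  hmv _ fun t => loc_dH_le_of_ineq190 (h190 t) hC hd hrow hσ B hm y

/-- **(1.87) p. 197 FROM (1.84) AND (190)**: the three local sizes of (1.87) (`bout₀` = `|𝔸₀|`, `bout₁` = `|∇^η𝔸₀|`, `bout₂`
= `|∂^{η*}∂^η𝔸₀|` on the blocks of `Z″_k`, weights of (190) inside), (190) for each at every base point, (2.61) at a rate
`σ ≤ ⅛δ₀`, the mean-value domination, the argument `B = (1/i)log M˙(U₀)` of (1.86) with B-size `≤ m`, `m ≤ K·B₃B₅M⁶ε_k`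
((1.84) through the chart), `Cκ_Bc ≤ B₃`, `B₃B₅M⁶ε_k > 0` and any `C′ > K`: the typed leaf `Ineq187 (bout₀.loc y 𝔸₀)
(bout₁.loc y 𝔸₀) (bout₂.loc y 𝔸₀) C′ B₃ B₅ M ε_k`, i.e. *"|𝔸₀|, |∇^η𝔸₀|, |∂^{η*}∂^η𝔸₀| < O(1)B₃²B₅M⁶ε_k"* with `O(1) = C′`.
[cite: Balaban1989LargeFieldI, (1.87) p.197; Balaban1985Variational, (190) p.308] -/
theorem ineq187_of_ineq190 {T : Type*} {bB : BlockNorm g FB} {bout₀ bout₁ bout₂ : BlockNorm g FA}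
    {dH : T → FB →ₗ[ℝ] FA} {C δ₀ σ c m K C' B₃ B₅ M εk : ℝ}
    (h190₀ : ∀ t, Ineq190 bB bout₀ (dH t) C δ₀) (h190₁ : ∀ t, Ineq190 bB bout₁ (dH t) C δ₀)
    (h190₂ : ∀ t, Ineq190 bB bout₂ (dH t) C δ₀) (hC : 0 ≤ C) (hd : ∀ a b : g.Site, 0 ≤ g.dist a b)
    (hrow : RowSum g σ c) (hσ : σ ≤ δ₀ / 8) (B : FB) (hm : ∀ y', bB.loc y' B ≤ m) (y : g.Site) {HB : FA}
    (hmv₀ : ∀ s : ℝ, (∀ t, bout₀.loc y (dH t B) ≤ s) → bout₀.loc y HB ≤ s)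
    (hmv₁ : ∀ s : ℝ, (∀ t, bout₁.loc y (dH t B) ≤ s) → bout₁.loc y HB ≤ s)
    (hmv₂ : ∀ s : ℝ, (∀ t, bout₂.loc y (dH t B) ≤ s) → bout₂.loc y HB ≤ s)
    (hmK : m ≤ K * (B₃ * B₅ * M ^ 6 * εk)) (hCB : C * bB.κ * c ≤ B₃) (hc : 0 ≤ c)
    (hpos : 0 < B₃ * B₅ * M ^ 6 * εk) (hC' : K < C') :
    Ineq187 (bout₀.loc y HB) (bout₁.loc y HB) (bout₂.loc y HB) C' B₃ B₅ M εk := by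
  have hm0 : 0 ≤ m := (bB.loc_nonneg y B).trans (hm y)
  have hCκc : 0 ≤ C * bB.κ * c := mul_nonneg (mul_nonneg hC bB.κ_nonneg) hc
  -- the common bound `Cκ_Bc·m ≤ B₃·K·(B₃B₅M⁶ε_k) < C′B₃²B₅M⁶ε_k`
  have hB₃ : 0 ≤ B₃ := hCκc.trans hCB
  have hstep : C * bB.κ * c * m ≤ B₃ * (K * (B₃ * B₅ * M ^ 6 * εk)) :=
    mul_le_mul hCB hmK hm0 hB₃
  have hB₃pos : 0 < B₃ := by
    rcases hB₃.eq_or_lt with h | h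
    · exfalso; rw [← h] at hpos; simp at hpos
    · exact h
  have hstrict : B₃ * (K * (B₃ * B₅ * M ^ 6 * εk)) < C' * B₃ ^ 2 * B₅ * M ^ 6 * εk := by
    have h1 : K * (B₃ * B₅ * M ^ 6 * εk) < C' * (B₃ * B₅ * M ^ 6 * εk) := mul_lt_mul_of_pos_right hC' hpos
    have h2 := mul_lt_mul_of_pos_left h1 hB₃pos
    calc B₃ * (K * (B₃ * B₅ * M ^ 6 * εk)) < B₃ * (C' * (B₃ * B₅ * M ^ 6 * εk)) := h2
      _ = C' * B₃ ^ 2 * B₅ * M ^ 6 * εk := by ring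
  have hlt : C * bB.κ * c * m < C' * B₃ ^ 2 * B₅ * M ^ 6 * εk := hstep.trans_lt hstrict
  exact ⟨(loc_le_global_of_meanValue h190₀ hC hd hrow hσ B hm y hmv₀).trans_lt hlt,
    (loc_le_global_of_meanValue h190₁ hC hd hrow hσ B hm y hmv₁).trans_lt hlt,
    (loc_le_global_of_meanValue h190₂ hC hd hrow hσ B hm y hmv₂).trans_lt hlt⟩

/-! ## §5 (v1.2). p. 199: the two `ℍ`-function bounds feeding (1.97)/(1.98) -/

/-- **p. 199, first ℍ-bound**: *"The ℍ-function in the expansion can be bounded on the domain Z″_{j+1}∖Z″_j for h < j < k,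
Z″_{h+1}∖(Ω″^∼_{h+1})^c for j = h, and Ω^c_k∖Z″_k for j = k, by B₃exp(−δ(M/M₁)(j − h))exp(−½δMR_h)23d²ε_h"* — from (190)
for the size `bout` at every base point, (2.61), the argument field (the layer `Σ`, *"This field can be bounded by … <
23d²ε_h"*) of B-size `≤ 23d²ε_h` vanishing on the blocks closer than `D` with `δ(M/M₁)n + ½δMR_h ≤ τD` (`n = j − h`),
`Cκ_Bc ≤ B₃`, mean-value domination: the first member of r12's `B15Bounds199.chainB_le`.
[cite: Balaban1989LargeFieldI, (1.97) p.199; Balaban1985Variational, (190) p.308] -/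
theorem boundH199B_of_ineq190 {T : Type*} {bB : BlockNorm g FB} {bout : BlockNorm g FA}
    {dH : T → FB →ₗ[ℝ] FA} {C δ₀ σ τ c D B₃ δ M M₁ Rh n d εh : ℝ}
    (h190 : ∀ t, Ineq190 bB bout (dH t) C δ₀) (hC : 0 ≤ C) (hd : ∀ a b : g.Site, 0 ≤ g.dist a b)
    (hrow : RowSum g σ c) (hτ : 0 ≤ τ) (hστ : σ + τ ≤ δ₀ / 8) (B : FB) (y : g.Site)
    (hm : ∀ y', bB.loc y' B ≤ 23 * d ^ 2 * εh) (hD : ∀ y', bB.loc y' B ≠ 0 → D ≤ g.dist y y')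
    {HB : FA} (hmv : ∀ s : ℝ, (∀ t, bout.loc y (dH t B) ≤ s) → bout.loc y HB ≤ s)
    (hgeom : δ * (M / M₁) * n + δ * M / 2 * Rh ≤ τ * D) (hCB : C * bB.κ * c ≤ B₃) (hB₃ : 0 ≤ B₃) (hεh : 0 ≤ εh) :
    bout.loc y HB ≤ B₃ * Real.exp (-(δ * (M / M₁) * n)) * Real.exp (-(δ * M / 2 * Rh)) * (23 * d ^ 2) * εh := by
  have h := loc_le_of_meanValue h190 hC hd hrow hτ hστ B hm y hD hmv
  have hexp : Real.exp (-(τ * D)) ≤ Real.exp (-(δ * (M / M₁) * n)) * Real.exp (-(δ * M / 2 * Rh)) := by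
    rw [← Real.exp_add]
    exact Real.exp_le_exp.mpr (by linarith)
  have ha : 0 ≤ 23 * d ^ 2 * εh := by positivity
  have h2 : C * bB.κ * c * (23 * d ^ 2 * εh) * Real.exp (-(τ * D))
      ≤ B₃ * (23 * d ^ 2 * εh) * (Real.exp (-(δ * (M / M₁) * n)) * Real.exp (-(δ * M / 2 * Rh))) :=
    mul_le_mul (mul_le_mul_of_nonneg_right hCB ha) hexp (Real.exp_nonneg _) (by positivity)
  calc bout.loc y HB ≤ B₃ * (23 * d ^ 2 * εh) * (Real.exp (-(δ * (M / M₁) * n)) * Real.exp (-(δ * M / 2 * Rh))) :=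
      h.trans h2
    _ = B₃ * Real.exp (-(δ * (M / M₁) * n)) * Real.exp (-(δ * M / 2 * Rh)) * (23 * d ^ 2) * εh := by ring

/-- **p. 199, second ℍ-bound**: *"We expand the above function with respect to the variables B′. The corresponding
ℍ-function can be bounded on the same domains as above by B₃δ′_k"* — from (190) UNLOCALISED (the argument `B′` has B-size
`≤ δ′_k` by `χ′` (1.82)), (2.61) at rate `σ ≤ ⅛δ₀`, `Cκ_Bc ≤ B₃`, mean-value domination: the first member of r12's
`B15Bounds199.chainC_le`. [cite: Balaban1989LargeFieldI, (1.97) p.199; Balaban1985Variational, (190) p.308] -/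
theorem boundH199C_of_ineq190 {T : Type*} {bB : BlockNorm g FB} {bout : BlockNorm g FA}
    {dH : T → FB →ₗ[ℝ] FA} {C δ₀ σ c B₃ δ'k : ℝ}
    (h190 : ∀ t, Ineq190 bB bout (dH t) C δ₀) (hC : 0 ≤ C) (hd : ∀ a b : g.Site, 0 ≤ g.dist a b)
    (hrow : RowSum g σ c) (hσ : σ ≤ δ₀ / 8) (B : FB) (y : g.Site) (hm : ∀ y', bB.loc y' B ≤ δ'k)
    {HB : FA} (hmv : ∀ s : ℝ, (∀ t, bout.loc y (dH t B) ≤ s) → bout.loc y HB ≤ s)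
    (hCB : C * bB.κ * c ≤ B₃) : bout.loc y HB ≤ B₃ * δ'k := by
  have h := loc_le_global_of_meanValue h190 hC hd hrow hσ B hm y hmv
  have hδ : 0 ≤ δ'k := (bB.loc_nonneg y B).trans (hm y)
  exact h.trans (mul_le_mul_of_nonneg_right hCB hδ)

end Literature.MathematicalPhysics.QuantumFieldTheory.Balaban1983to89.B15HDecayLeaves
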